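import Summits.AtomisticToContinuum.Crystallization.Theorems.PalmUnimodularRigidityMinimiserShellsTwoLevelMono

/-!
# Line `exact-elastic-split` — crux `MinimiserShells` (stmt-AtomisticToContinuum-9225), LIVE skeleton r2 (lead c19, 2026-08-17)

r1 (strategist seat `cstrat-stmt-AtomisticToContinuum-9225-s1`, registered by lead c19) had two stubs: `stub_coarseShellGap :
Split.CoarseShellGapStmt` (the open core) and `stub_clusterCoercivityLoose` (the level-`1/20` cluster family
`∀ θ ∈ (0, 1/20], ClusterCoerciveAt (1/20) θ`).  r2 RESHAPES, using only landed files: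

* **stub 1 is carried BY NAME** as the accepted `@[conjecture]` declaration
  `Summit.AtomisticToContinuum.Crystallization.LennardJonesCoarseShellGapConjecture` (p159569; `= ShellGap (1/20)`,
  `lennardJonesCoarseShellGapConjecture_iff_shellGap`; certified NECESSARY for the crux,
  `lennardJonesCoarseShellGapConjecture_of_minimiserShells`) — the WEAKEST certified-necessary open statement (coarse
  three-dimensional Lennard-Jones crystallization in first-shell form, Blanc–Lewin 2015 §2.3), so that the machine-readable
  state of the crux is "blocked on that conjecture + the e*-free rungs below";
* **stub 2 is cut along the level cascade (P0 of the line card, landed p160087)** into RUNG 0,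
  `stub_clusterRungZero : ClusterCoerciveAt (1/20) (1/40)` — ONE concrete finite-cluster inequality with both levels fixed
  (price the sites more than `a/100 + 1/40` off the patterns inside `(a/100 + 1/20)`-good `R`-balls) — and the TAIL
  `stub_clusterRungsTail : ∀ k, ClusterCoerciveAt ((1/40)/2^k) ((1/40)/2^(k+1))` (every later rung lives within `3.5 %` of
  the patterns, the near-harmonic regime).  The rungs are WEAKER than r1's stub 2 (`TwoLevel.dyadicRungs_of_clusterFamily`,
  by `clusterCoerciveAt_mono_coarse`) and still sufficient (`TwoLevel.minimiserShells_of_coarseGap_and_dyadicRungs`: level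
  cascade `coarseToFineAt_trans` + two-level transfer + exact residual p149424).

Composition: `MinimiserShells_proof` = the landed `TwoLevel.minimiserShells_of_coarseConjecture_rungZero_tail` fed by the three
stubs (hypothesis-free, the only crux-concluding theorem of this file — the skeleton checker takes the first such theorem in
environment order and requires stub-named binders).  Read-backs: `stub1_of_minimiserShells` (necessity of stub 1, landed),
`rungs_of_r1_stub2` (r1's registered stub 2 ⇒ both rung stubs' statements, landed monotonicity).

Disproof used (`Cruxes/MinimiserShells/Disproof.lean`, gens 1–3; `-- Targets`: none on these statements; `Negative/*` unchanged
since 2026-08-16): as r1 — entry only through periodic gaps; no slack / pointwise / linear-in-mismatch pricing (17253's dilation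
family pays ≥ 3e-2 per site at 4 %, far above any rung constant); stub 2's rungs price only fine-bad sites inside coarsely good
`R`-balls on finite clusters, so `Negative.PricingCeiling` (all bad shells vs e*) does not apply.
-/

noncomputable section

open MeasureTheory
open scoped ENNReal BigOperators Classical

namespace Summit.AtomisticToContinuum.Crystallization.Cruxes.MinimiserShells.ExactElasticSplit

open Summit.AtomisticToContinuum.Crystallization.Theses.PalmUnimodularRigidity (MinimiserShells)
open Summit.AtomisticToContinuum.Crystallization (LennardJonesCoarseShellGapConjecture
  lennardJonesCoarseShellGapConjecture_of_minimiserShells)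
open Summit.AtomisticToContinuum.Crystallization.Theorems.PalmUnimodularRigidityMinimiserShells.TwoLevel
  (ClusterCoerciveAt minimiserShells_of_coarseConjecture_rungZero_tail dyadicRungs_of_clusterFamily
   zero_and_tail_of_dyadicRungs)

/-! ## The three registered stubs -/

/-- **Stub 1 — THE OPEN CORE, by name: `LennardJonesCoarseShellGapConjecture`** (accepted `@[conjecture] def`, p159569;
`= Residual.ShellGap (1/20)`): for every `t > 0` some `κ > 0` makes every periodic configuration of `ℝ³` with `1/3`-separated
points and at least `t·#motif` motif sites failing even the COARSE shell test (tolerance `a/100 + 1/20`, radius `(5/4 − 1/20)·a`,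
`a ∈ [9/10, 1]`, FCC or HCP pattern) have `e_LJ(Q) ≥ e* + κ`.  Coarse 3-D Lennard-Jones crystallization in first-shell form —
OPEN (Blanc–Lewin 2015 §2.3); certified NECESSARY for the crux (`stub1_of_minimiserShells`).  Declared open; nothing in this
line attacks it (recommended: conditional bridge `--conditional-on` this decl). -/
theorem stub_lennardJonesCoarseShellGapConjecture : LennardJonesCoarseShellGapConjecture := by
  sorry

/-- **Stub 2a — RUNG 0 of the e*-free half: `ClusterCoerciveAt (1/20) (1/40)`.**  Some `c > 0` admits, for every `ε > 0`,
`R > 0` and `C ≥ 0` such that every finite injective `1/3`-separated cluster `y : Fin N → ℝ³` satisfies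
`c·#{i : (1/40)-loosely bad, every j within R of i (1/20)-loosely good} − C·#{j : (1/20)-loosely bad} − ε·N ≤ 𝓔_N(y) − N·e*`.
Content: sites whose first shell is more than `a/100 + 1/40` (≈ 3.5 %) off every scaled/rotated FCC/HCP pattern, inside an
`R`-ball of shells all within `a/100 + 1/20` (≈ 6 %) of the patterns, pay `c` each; `e*` enters only through
`N'·e* ≤ 𝓔(reference patch)` (`card_mul_eStar_le`).  This rung carries the NON-CONVEX part of the 6 % tube (12 %-stretched
bonds have lost most of their stiffness): energy coercivity (star-shaped basin) around the patch's own constrained minimiser,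
local chart at 6 % slack, interior regularity, charging — line card P1–P5.  XL. -/
theorem stub_clusterRungZero : ClusterCoerciveAt (1 / 20) (1 / 40) := by
  sorry

/-- **Stub 2b — THE TAIL RUNGS: `ClusterCoerciveAt ((1/40)/2^k) ((1/40)/2^(k+1))`, `k : ℕ`.**  Rung `k+1` of the dyadic
ladder: sites more than `a/100 + (1/40)/2^(k+1)` off the patterns, inside `R`-balls all of whose shells are within
`a/100 + (1/40)/2^k ≤ a/100 + 1/40` (≈ 3.5 %) of them, pay `c_k > 0` each (constants may depend on `k`).  Every tail rung lives
in the near-harmonic regime (bond stretches ≤ 7 %, inside the convex range of `V_LJ`, inflection at 14 %): certified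
phonon/Born positivity of the Barlow stackings uniformly in the stacking word + anharmonic remainder + the 1 % pattern
tolerance geometry.  XL (of a genre with theorems: E–Ming / Ortner–Theil Cauchy–Born validity). -/
theorem stub_clusterRungsTail : ∀ k : ℕ, ClusterCoerciveAt ((1 / 40 : ℝ) / 2 ^ k) ((1 / 40 : ℝ) / 2 ^ (k + 1)) := by
  sorry

/-! ## The skeleton: the crux from the three stubs, BY NAME -/

/-- **THE SKELETON (r2): `MinimiserShells` from the three registered stubs** — the landed composition
`TwoLevel.minimiserShells_of_coarseConjecture_rungZero_tail` (rung 0 + tail = all dyadic rungs; level cascade and two-level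
transfer, p160087; coarse conjecture = `ShellGap (1/20)`, p159569; exact residual, p149424). -/
theorem MinimiserShells_proof : MinimiserShells :=
  minimiserShells_of_coarseConjecture_rungZero_tail stub_lennardJonesCoarseShellGapConjecture stub_clusterRungZero
    stub_clusterRungsTail

/-! ## Read-backs (landed facts about the stubs) -/

/-- Stub 1 is NECESSARY for the crux (landed, p159569 ← p123347): the line cannot be cheaper than its open core. -/
theorem stub1_of_minimiserShells (h : MinimiserShells) : LennardJonesCoarseShellGapConjecture :=
  lennardJonesCoarseShellGapConjecture_of_minimiserShells h

/-- r1's registered stub 2 (the level-`1/20` cluster family) IMPLIES both rung stubs' statements (landed monotonicity):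
r2's e*-free obligations are weaker than r1's. -/
theorem rungs_of_r1_stub2 (h : ∀ θ : ℝ, 0 < θ → θ ≤ 1 / 20 → ClusterCoerciveAt (1 / 20) θ) :
    ClusterCoerciveAt (1 / 20) (1 / 40) ∧
      ∀ k : ℕ, ClusterCoerciveAt ((1 / 40 : ℝ) / 2 ^ k) ((1 / 40 : ℝ) / 2 ^ (k + 1)) :=
  zero_and_tail_of_dyadicRungs (dyadicRungs_of_clusterFamily h)

end Summit.AtomisticToContinuum.Crystallization.Cruxes.MinimiserShells.ExactElasticSplit

end
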